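import Summits.HodgeConjecture.HodgeConjecture.Theorems.Ring2AtlasCMSixfolds
import Literature.AlgebraicGeometry.Pohlmann1968.SimpleCMAbelianVarietyPowersDivisorGenerated
import HarnessLib

/-!
# The simple CM rows of prime dimension (and the isotypic cells over them) are CLOSED UNCONDITIONALLY; in particular
# `hodgeSimpleCMSevenfold_holds : Ring2.Atlas.HodgeSimpleCMSevenfold`

Cell `pub-hodgecm2` (COR-CM), count-neutral, literature seat `lit-deligne-3` gen 5; KERNEL ONLY (theorems, no
definition, no named fact); `HC_CM` is NOT used.  NEW as assembled (hence under `Summits/`), every input a tree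
theorem:

* the Literature theorem `Pohlmann1968.isDivisorGenerated_powSucc_of_isSimple_of_isOfCMType_of_prime` (the CM
  case of Tankeev–Ribet — Gordon 1999 Thm. 6.3 (2), Corollary and Remark [Yanai 1985]; Moonen–Zarhin 1999 (2.7) for
  `X` of CM type — in the literal geometric form: `X` simple, of CM type (`Milne1999.IsOfCMType`), of prime dimension
  ⟹ every power `X^{N+1}` is divisor-generated), and its `dim ≤ 3` companion (Ribet 1980 (3.7));
* the class-target vocabulary `HCOnClass` of the `g ≤ 7` atlas (`Theorems/Ring2ClassTargets`), whose row
  `Ring2.Atlas.HodgeSimpleCMSevenfold := HCOnClass fun A ↦ A.dim = 7 ∧ A.IsSimple ∧ IsOfCMType A`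
  (`Theorems/Ring2AtlasCMSixfolds` §2) was closed so far ONLY modulo the named fact
  `TankeevRibet1983_hodgeClasses_divisorial_powers_simplePrimeDimension` (`hodgeSimpleCMSevenfold_of_tankeevRibet`)
  or modulo `HC_CM` (`hodgeSimpleCMSevenfold_of_cmAbelianHodge`).

Results (all unconditional, axioms standard):

* `hcOnClass_isSimple_isOfCMType_prime` — `HCOnClass fun A ↦ A.IsSimple ∧ IsOfCMType A ∧ A.dim.Prime`: the Hodge
  conjecture for every simple complex abelian variety of CM type of prime dimension;
* `hcOnClass_isIsogenous_powSucc_isSimple_isOfCMType_prime` — … and for everything isogenous to a power of one (the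
  isotypic CM cells `B ∼ Xᵏ`, `X` simple CM of prime dimension: dimensions `kp`);
* `hcOnClass_isIsogenous_powSucc_isSimple_isOfCMType_dim_le_three` — the isotypic cells over simple CM curves,
  surfaces, threefolds (all dimensions `k`, `2k`, `3k`);
* `hodgeSimpleCMSevenfold_holds : Ring2.Atlas.HodgeSimpleCMSevenfold` — the atlas row `g = 7`, simple, CM-type, now a
  tree theorem WITHOUT the Tankeev–Ribet fact; likewise the rows `g ∈ {2, 3, 5}` simple CM
  (`hcOnClass_dim_eq_isSimple_isOfCMType_of_prime`).

What is NOT touched: the non-CM simple rows of prime dimension (Tankeev / Ribet 1983 Thms. 1, 3: still the named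
fact, see `Pohlmann1968.tankeevRibet1983_iff_nonCM`); `HodgeSimpleCMSixfold` (degenerate sextic types exist; Weil
classes needed); `HC_CM` itself.

## References

* [Gordon1999HodgeAVSurvey] B. B. Gordon, *A survey of the Hodge conjecture for abelian varieties* (1999),
  Thm. 6.3, Corollary, Remark; Thm. 6.4 (held `paper:arxiv-alg-geom_9709030` p0018 L55–L76).
* [MoonenZarhin1999LowDim] B. Moonen, Yu. Zarhin, Math. Ann. 315 (1999), §2 Thm. (2.7).
* [Yanai1985] H. Yanai, Nagoya Math. J. 97 (1985), §4 Theorem.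
* [Ribet1980] K. A. Ribet, Mém. SMF 2 (1980), §3 (3.7).
* [Ribet1983] K. A. Ribet, Amer. J. Math. 105 (1983), Thms. 0–3.
* [Deligne2000] P. Deligne, *The Hodge conjecture* (Clay, 2000), §1.
-/

noncomputable section

open CategoryTheory

namespace Summit.HodgeConjecture.CorCM

open Literature.AlgebraicGeometry Literature.AlgebraicGeometry.Motives
open Literature.AlgebraicGeometry.Motives.AbelianVariety
open Literature.AlgebraicGeometry.HodgeTheory
open Literature.AlgebraicGeometry.Milne1999
open Literature.AlgebraicGeometry.Pohlmann1968
open Summit.HodgeConjecture.HodgeConjecture.Ring2.ClassTargets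
open Summit.HodgeConjecture.HodgeConjecture.Ring2.Atlas

/-- **The Hodge conjecture for every simple complex abelian variety of CM type of prime dimension**, as a closed
class target, UNCONDITIONAL. [cite: Gordon1999HodgeAVSurvey, Thm. 6.3, Corollary and Remark]
[cite: MoonenZarhin1999LowDim, §2 Thm. (2.7)] [cite: Yanai1985, §4 Theorem] [cite: Deligne2000, §1] -/
theorem hcOnClass_isSimple_isOfCMType_prime : HCOnClass fun A ↦ A.IsSimple ∧ IsOfCMType A ∧ A.dim.Prime :=
  fun A hA ↦ hodgeConjectureFor_of_isSimple_of_isOfCMType_of_prime A hA.2.2 rfl hA.1 hA.2.1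

/-- **… together with every complex abelian variety isogenous to a power `X^{N+1}` of such an `X`** (the isotypic
CM cells of dimension `(N+1)p`), UNCONDITIONAL. [cite: MoonenZarhin1999LowDim, §2 Thm. (2.7)]
[cite: vanGeemen1994HodgeAV, Lemma 3.7 and Thm. 4.6] [cite: Deligne2000, §1] -/
theorem hcOnClass_isIsogenous_powSucc_isSimple_isOfCMType_prime :
    HCOnClass fun B ↦ ∃ (X : AbelianVariety ℂ) (N : ℕ),
      X.IsSimple ∧ IsOfCMType X ∧ X.dim.Prime ∧ IsIsogenous B (X.powSucc N) :=
  fun _ ⟨_, _, hs, hcm, hp, hiso⟩ ↦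
    hodgeConjectureFor_of_isIsogenous_powSucc_of_isSimple_of_isOfCMType_of_prime hp rfl hs hcm hiso

/-- **The isotypic cells over simple CM curves, surfaces and threefolds**: the Hodge conjecture for every complex
abelian variety isogenous to a power of a simple CM abelian variety of dimension `≤ 3`, UNCONDITIONAL (Ribet 1980
(3.7): such CM types are nondegenerate). [cite: Ribet1980, §3 Examples (3.7) (p. 87)]
[cite: Gordon1999HodgeAVSurvey, Thm. 6.4 and §9.3] [cite: Deligne2000, §1] -/
theorem hcOnClass_isIsogenous_powSucc_isSimple_isOfCMType_dim_le_three :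
    HCOnClass fun B ↦ ∃ (X : AbelianVariety ℂ) (N : ℕ),
      X.IsSimple ∧ IsOfCMType X ∧ 0 < X.dim ∧ X.dim ≤ 3 ∧ IsIsogenous B (X.powSucc N) :=
  fun _ ⟨_, _, hs, hcm, h0, h3, hiso⟩ ↦
    hodgeConjectureFor_of_isIsogenous_powSucc_of_isSimple_of_isOfCMType_of_dim_le_three hs h0 h3 hcm hiso

/-- **The atlas rows `g = p` prime, simple, CM-type are closed unconditionally** (shape of
`Ring2.Atlas.HodgeSimpleCMSevenfold` for an arbitrary prime). [cite: Gordon1999HodgeAVSurvey, Thm. 6.3, Corollary and Remark]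
[cite: Deligne2000, §1] -/
theorem hcOnClass_dim_eq_isSimple_isOfCMType_of_prime {p : ℕ} (hp : p.Prime) :
    HCOnClass fun A ↦ A.dim = p ∧ A.IsSimple ∧ IsOfCMType A :=
  fun A hA ↦ hodgeConjectureFor_of_isSimple_of_isOfCMType_of_prime A hp hA.1 hA.2.1 hA.2.2

/-- **The atlas row `g = 7`, simple, of CM-type (`Ring2.Atlas.HodgeSimpleCMSevenfold`) is a tree theorem — without
the Tankeev–Ribet fact and without `HC_CM`.**  (Previously: `hodgeSimpleCMSevenfold_of_tankeevRibet`,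
`hodgeSimpleCMSevenfold_of_cmAbelianHodge`.)  Its class is inhabited
(`Ring2.Atlas.exists_isSimpleCMSevenfold_of_cmAbelianVarietyRealised`, with the tree theorem
`cmAbelianVarietyRealised_holds`). [cite: Gordon1999HodgeAVSurvey, Thm. 6.3, Corollary and Remark]
[cite: Yanai1985, §4 Theorem] [cite: Dodson1987, Thm. 1.0 (v)] [cite: Deligne2000, §1] -/
theorem hodgeSimpleCMSevenfold_holds : HodgeSimpleCMSevenfold :=
  hcOnClass_dim_eq_isSimple_isOfCMType_of_prime (by norm_num)

/-- The rows `g = 2, 3, 5` simple CM likewise (instances of `hcOnClass_dim_eq_isSimple_isOfCMType_of_prime`; for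
`g = 2, 3` also instances of the unconditional `dim ≤ 3` theorem of the tree). [cite: Gordon1999HodgeAVSurvey, Thm. 6.3, Corollary and Remark]
[cite: Deligne2000, §1] -/
theorem hcOnClass_dim_five_isSimple_isOfCMType : HCOnClass fun A ↦ A.dim = 5 ∧ A.IsSimple ∧ IsOfCMType A :=
  hcOnClass_dim_eq_isSimple_isOfCMType_of_prime (by norm_num)

end Summit.HodgeConjecture.CorCM

end
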